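import Summits.AtomisticToContinuum.HydrodynamicLimit.Theses.CollisionIsometryCLT
import Literature.Analysis.FluidPDE.HardSphereCollisionRecord
import Literature.Analysis.FluidPDE.HardSphereEuclideanTransfer
import Literature.MathematicalPhysics.KineticTheory.HardSphereEulerProofs

/-!
# `stub_affineSlaving` of line `hemisphere-affine-slaving` is FALSE as stated (stub-misstated)

Negative knowledge for the crux `CollisionIsometryCLT.CollisionalTransferLocality`
(stmt-AtomisticToContinuum-9518), line `hemisphere-affine-slaving`
(`Cruxes/CollisionalTransferLocality/Lines/hemisphere-affine-slaving.lean`), registered stub 2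
`Holds.stub_affineSlaving : AffineSlavingIdentity` ("the LEVER": `chaosAvg = affW` for every
nonnegative kernel and EVERY pair of test fields `ψ, χ`).

The definitions below (`rhoB` … `AffineSlavingIdentity`) are VERBATIM copies of the skeleton's, so
`AffineSlavingIdentity` here is syntactically the skeleton's statement.

**Why it is false.** The identity mixes two torus derivatives that disagree off smooth fields:
`affW` contains `divPsi ψ s x = Torus.divergence (ψ s) x = ∑ i, Torus.partialDeriv i (ψ s · i) x`
(one-dimensional `deriv`s along the coordinate lines), whereas `chaosNum` and `kinW` only see
`gradPsi ψ s x a b = Torus.gradient (ψ s · a) x b` (Mathlib's Fréchet `gradient` of the lift, junk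
`0` where the lift is not Fréchet differentiable). For the test field
`ψ s y = e₀ · (reprSym y 0 + |reprSym y 1|)` the lift at `x = 0` is `v ↦ v 0 + |v 1|`: not
differentiable at `0` (so `gradPsi ≡ 0`, `sphNum ≡ 0`, `chaosAvg = 0`), while its partial
derivative along `e₀` is `1` (so `divPsi = 1`, `kinW = 0`, and on the two-particle configuration
`w = [(0, e₀), (0, 0)]` with the constant kernel `φ ≡ 1`: `ρ̄ = 1`, `θ̄ = 1/12`, `affW = 1/3`).

**Classification: stub-misstated.** Repaired statement `C′` (what stub 6 actually consumes): the
identity for tests whose lifts are differentiable at the block point, e.g.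
`∀ ψ χ φ N s w x, (∀ a, Torus.IsSmooth (fun y => ψ s y a)) → Torus.IsSmooth (χ s) →
(∀ y, 0 ≤ φ N y) → chaosAvg ψ χ φ N s w x = affW ψ χ φ N s w x`
(or: replace `divPsi` by `∑ a, gradPsi ψ s x a a` inside `eulerW` and bridge to
`Torus.divergence` for smooth tests in the reduction stub). The witness below is not smooth, so it
misses `C′`.
-/

noncomputable section

open scoped BigOperators Topology Classical MeasureTheory InnerProductSpace ENNReal
open Filter Set Function MeasureTheory

namespace Summit.AtomisticToContinuum.HydrodynamicLimit.Theorems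

namespace CollisionalTransferLocalityAffineSlavingFalse

/-! ## Verbatim copies of the skeleton's definitions -/

/-- Macroscopic torus. [folklore] -/
abbrev T3 : Type := UnitAddTorus (Fin 3)
/-- Velocity space. [folklore] -/
abbrev V3 : Type := EuclideanSpace ℝ (Fin 3)
/-- Phase space of `N + 1` spheres on `𝕋³`. [folklore] -/
abbrev Cfg (N : ℕ) : Type :=
  Literature.Analysis.FluidPDE.Config (N + 1) (Fin 3) (UnitAddTorus (Fin 3))

/-- Block density `ρ̄` (verbatim). [folklore] -/
def rhoB (φ : ℕ → T3 → ℝ) (N : ℕ) (z : Cfg N) (x : T3) : ℝ :=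
  Literature.MathematicalPhysics.KineticTheory.empiricalDensityField z (fun y => φ N (y - x))
/-- Block momentum `m̄` (verbatim). [folklore] -/
def mB (φ : ℕ → T3 → ℝ) (N : ℕ) (z : Cfg N) (x : T3) : V3 :=
  Literature.MathematicalPhysics.KineticTheory.empiricalMomentumField z (fun y => φ N (y - x))
/-- Block energy `Ē` (verbatim). [folklore] -/
def EB (φ : ℕ → T3 → ℝ) (N : ℕ) (z : Cfg N) (x : T3) : ℝ :=
  Literature.MathematicalPhysics.KineticTheory.empiricalEnergyField z (fun y => φ N (y - x))
/-- Block velocity `ū` (verbatim). [folklore] -/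
def uB (φ : ℕ → T3 → ℝ) (N : ℕ) (z : Cfg N) (x : T3) : V3 :=
  (rhoB φ N z x)⁻¹ • mB φ N z x
/-- Block temperature `θ̄` (verbatim). [folklore] -/
def thetaB (φ : ℕ → T3 → ℝ) (N : ℕ) (z : Cfg N) (x : T3) : ℝ :=
  2 / 3 * (EB φ N z x / rhoB φ N z x - ‖mB φ N z x‖ ^ 2 / (2 * rhoB φ N z x ^ 2))
/-- Block kinetic pressure `ρ̄ θ̄` (verbatim). [folklore] -/
def pkin (φ : ℕ → T3 → ℝ) (N : ℕ) (z : Cfg N) (x : T3) : ℝ :=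
  rhoB φ N z x * thetaB φ N z x
/-- Block traceless central kinetic stress (verbatim). [folklore] -/
def Dst (φ : ℕ → T3 → ℝ) (N : ℕ) (z : Cfg N) (x : T3) (j k : Fin 3) : ℝ :=
  (∫ y, φ N (y.1 - x) * ((y.2 j - uB φ N z x j) * (y.2 k - uB φ N z x k))
      ∂(Literature.Analysis.FluidPDE.empiricalMeasure z)) -
    (if j = k then (∑ l : Fin 3, ∫ y, φ N (y.1 - x) * (y.2 l - uB φ N z x l) ^ 2
      ∂(Literature.Analysis.FluidPDE.empiricalMeasure z)) / 3 else 0)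
/-- Block kinetic heat flux (verbatim). [folklore] -/
def qfl (φ : ℕ → T3 → ℝ) (N : ℕ) (z : Cfg N) (x : T3) : V3 :=
  ∫ y, (φ N (y.1 - x) * ‖y.2 - uB φ N z x‖ ^ 2 / 2) • (y.2 - uB φ N z x)
    ∂(Literature.Analysis.FluidPDE.empiricalMeasure z)

/-- `∂_b ψ_a (s, x)` (verbatim: Fréchet `Torus.gradient`). [folklore] -/
def gradPsi (ψ : ℝ → T3 → V3) (s : ℝ) (x : T3) (a b : Fin 3) : ℝ :=
  Literature.Analysis.FunctionSpaces.Torus.gradient (fun y => ψ s y a) x b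
/-- `∇χ (s, x)` (verbatim). [folklore] -/
def gradChi (χ : ℝ → T3 → ℝ) (s : ℝ) (x : T3) : V3 :=
  Literature.Analysis.FunctionSpaces.Torus.gradient (χ s) x
/-- `div ψ (s, x)` (verbatim: `Torus.divergence`, a sum of one-dimensional `partialDeriv`s). [folklore] -/
def divPsi (ψ : ℝ → T3 → V3) (s : ℝ) (x : T3) : ℝ :=
  Literature.Analysis.FunctionSpaces.Torus.divergence (ψ s) x

/-- The Euler weight (verbatim). [folklore] -/
def eulerW (ψ : ℝ → T3 → V3) (χ : ℝ → T3 → ℝ) (φ : ℕ → T3 → ℝ) (N : ℕ) (s : ℝ) (z : Cfg N)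
    (x : T3) : ℝ :=
  divPsi ψ s x + ∑ j, gradChi χ s x j * uB φ N z x j

/-- The kinetic-correction weight (verbatim). [folklore] -/
def kinW (ψ : ℝ → T3 → V3) (χ : ℝ → T3 → ℝ) (φ : ℕ → T3 → ℝ) (N : ℕ) (s : ℝ) (z : Cfg N)
    (x : T3) : ℝ :=
  2 / 5 * ((∑ a, ∑ b, Dst φ N z x a b * gradPsi ψ s x a b) +
      (∑ a, ∑ b, Dst φ N z x a b * uB φ N z x b * gradChi χ s x a)) / pkin φ N z x +
    3 / 5 * (∑ a, qfl φ N z x a * gradChi χ s x a) / pkin φ N z x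

/-- The guarded affine weight (verbatim). [folklore] -/
def affW (ψ : ℝ → T3 → V3) (χ : ℝ → T3 → ℝ) (φ : ℕ → T3 → ℝ) (N : ℕ) (s : ℝ) (z : Cfg N)
    (x : T3) : ℝ :=
  if pkin φ N z x = 0 then 0 else (eulerW ψ χ φ N s z x + kinW ψ χ φ N s z x) / 3

/-- Sphere-side numerator (verbatim). [folklore] -/
def sphNum (ψ : ℝ → T3 → V3) (χ : ℝ → T3 → ℝ) (s : ℝ) (x : T3) (v v' : V3) : ℝ :=
  ∫ ω : Metric.sphere (0 : V3) 1,
      inner ℝ (v - v') (ω : V3) ^ 2 *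
        ((∑ a, ∑ b, (ω : V3) a * (ω : V3) b * gradPsi ψ s x a b) +
          inner ℝ ((1 / 2 : ℝ) • (v + v')) (ω : V3) * (∑ a, (ω : V3) a * gradChi χ s x a))
    ∂((volume : Measure V3).toSphere)

/-- Sphere-side flux normaliser (verbatim). [folklore] -/
def sphDen (v v' : V3) : ℝ :=
  ∫ ω : Metric.sphere (0 : V3) 1, inner ℝ (v - v') (ω : V3) ^ 2 ∂((volume : Measure V3).toSphere)

/-- Block numerator (verbatim). [folklore] -/
def chaosNum (ψ : ℝ → T3 → V3) (χ : ℝ → T3 → ℝ) (φ : ℕ → T3 → ℝ) (N : ℕ) (s : ℝ) (w : Cfg N)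
    (x : T3) : ℝ :=
  ∫ y, (∫ y', φ N (y.1 - x) * φ N (y'.1 - x) * sphNum ψ χ s x y.2 y'.2
    ∂(Literature.Analysis.FluidPDE.empiricalMeasure w)) ∂(Literature.Analysis.FluidPDE.empiricalMeasure w)

/-- Block flux normaliser (verbatim). [folklore] -/
def chaosDen (φ : ℕ → T3 → ℝ) (N : ℕ) (w : Cfg N) (x : T3) : ℝ :=
  ∫ y, (∫ y', φ N (y.1 - x) * φ N (y'.1 - x) * sphDen y.2 y'.2
    ∂(Literature.Analysis.FluidPDE.empiricalMeasure w)) ∂(Literature.Analysis.FluidPDE.empiricalMeasure w)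

/-- The flux-weighted chaos average (verbatim). [folklore] -/
def chaosAvg (ψ : ℝ → T3 → V3) (χ : ℝ → T3 → ℝ) (φ : ℕ → T3 → ℝ) (N : ℕ) (s : ℝ) (w : Cfg N)
    (x : T3) : ℝ :=
  chaosNum ψ χ φ N s w x / chaosDen φ N w x

/-- **The LEVER as stated by the skeleton** (verbatim copy of `AffineSlavingIdentity`; this is the
type of the registered stub `Holds.stub_affineSlaving`). [folklore] -/
def AffineSlavingIdentity : Prop :=
  ∀ (ψ : ℝ → T3 → V3) (χ : ℝ → T3 → ℝ) (φ : ℕ → T3 → ℝ) (N : ℕ) (s : ℝ) (w : Cfg N) (x : T3),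
    (∀ y, 0 ≤ φ N y) → chaosAvg ψ χ φ N s w x = affW ψ χ φ N s w x

/-! ## The witness -/

/-- Scalar test profile `y ↦ ỹ₀ + |ỹ₁|` in the symmetric chart `ỹ = reprSym y ∈ (-1/2, 1/2]³`:
its lift at `0` is `v ↦ v 0 + |v 1|` near `v = 0` — NOT Fréchet differentiable at `0`, but with
partial derivative `1` along `e₀`. [folklore] -/
def hW (y : T3) : ℝ :=
  Literature.Analysis.FluidPDE.Torus.reprSym y 0 + |Literature.Analysis.FluidPDE.Torus.reprSym y 1|

/-- Test vector field `ψ s y = hW y · e₀` (time-independent). [folklore] -/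
def ψW : ℝ → T3 → V3 := fun _ y => PiLp.single 2 (0 : Fin 3) (hW y)

/-- Test scalar field `χ ≡ 0`. [folklore] -/
def χW : ℝ → T3 → ℝ := fun _ _ => 0

/-- Constant kernel `φ ≡ 1` (nonnegative). [folklore] -/
def φW : ℕ → T3 → ℝ := fun _ _ => 1

/-- Two particles at the origin with velocities `e₀` and `0`. [folklore] -/
def wW : Cfg 1 := ![((0 : T3), PiLp.single 2 (0 : Fin 3) (1 : ℝ)), ((0 : T3), (0 : V3))]

/-! ## Computations -/

/-- In the chart: `hW (0 + proj v) = v 0 + |v 1|` for `‖v‖ < 1/2`. [folklore] -/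
theorem hW_chart {v : V3} (hv : ‖v‖ < 1 / 2) :
    hW ((0 : T3) + Literature.Analysis.FunctionSpaces.Torus.proj v) = v 0 + |v 1| := by
  rw [zero_add, hW, Literature.Analysis.FluidPDE.Torus.reprSym_proj_of_norm_lt hv]

/-- The lift of `hW` at `0` is not Fréchet differentiable at `0`. [folklore] -/
theorem not_differentiableAt_lift_hW :
    ¬ DifferentiableAt ℝ (fun v : V3 => hW ((0 : T3) + Literature.Analysis.FunctionSpaces.Torus.proj v)) 0 := by
  intro hdiff
  -- near `0` the lift is `v ↦ v 0 + |v 1|`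
  have hev : (fun v : V3 => hW ((0 : T3) + Literature.Analysis.FunctionSpaces.Torus.proj v)) =ᶠ[𝓝 0]
      fun v : V3 => v 0 + |v 1| := by
    have hball : Metric.ball (0 : V3) (1 / 2) ∈ 𝓝 (0 : V3) := Metric.ball_mem_nhds _ (by norm_num)
    filter_upwards [hball] with v hv
    rw [Metric.mem_ball, dist_zero_right] at hv
    exact hW_chart hv
  have h1 : DifferentiableAt ℝ (fun v : V3 => v 0 + |v 1|) 0 := hdiff.congr_of_eventuallyEq hev.symm
  -- restrict to the line `t ↦ t • e₁`, along which the function is `t ↦ |t|`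
  set e₁ : V3 := PiLp.single 2 (1 : Fin 3) (1 : ℝ) with he₁
  have hline : DifferentiableAt ℝ (fun t : ℝ => t • e₁) 0 := differentiableAt_id.smul_const e₁
  have h1' : DifferentiableAt ℝ (fun v : V3 => v 0 + |v 1|) ((fun t : ℝ => t • e₁) 0) := by
    simpa using h1
  have hcomp : DifferentiableAt ℝ ((fun v : V3 => v 0 + |v 1|) ∘ fun t : ℝ => t • e₁) 0 :=
    DifferentiableAt.comp (0 : ℝ) h1' hline
  have habs : ((fun v : V3 => v 0 + |v 1|) ∘ fun t : ℝ => t • e₁) = (abs : ℝ → ℝ) := by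
    funext t
    simp [he₁]
  rw [habs] at hcomp
  exact not_differentiableAt_abs_zero hcomp

/-- `gradPsi` of the witness vanishes identically at `(s, x) = (0, 0)` (junk `0` of the Fréchet
gradient at a non-differentiability point; the other components are constants). [folklore] -/
@[simp] theorem gradPsi_witness (a b : Fin 3) : gradPsi ψW 0 0 a b = 0 := by
  unfold gradPsi Literature.Analysis.FunctionSpaces.Torus.gradient
  by_cases ha : a = 0
  · subst ha
    have hfun : Literature.Analysis.FunctionSpaces.Torus.liftAt (fun y => ψW 0 y 0) (0 : T3) =
        fun v : V3 => hW ((0 : T3) + Literature.Analysis.FunctionSpaces.Torus.proj v) := by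
      funext v
      simp [Literature.Analysis.FunctionSpaces.Torus.liftAt, ψW]
    rw [hfun, gradient_eq_zero_of_not_differentiableAt not_differentiableAt_lift_hW]
    rfl
  · have hfun : Literature.Analysis.FunctionSpaces.Torus.liftAt (fun y => ψW 0 y a) (0 : T3) =
        fun _ : V3 => (0 : ℝ) := by
      funext v
      simp [Literature.Analysis.FunctionSpaces.Torus.liftAt, ψW, ha]
    rw [hfun, gradient_fun_const]
    rfl

/-- `gradChi` of the zero field vanishes. [folklore] -/
@[simp] theorem gradChi_witness (s : ℝ) (x : T3) : gradChi χW s x = 0 := by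
  unfold gradChi Literature.Analysis.FunctionSpaces.Torus.gradient
  have hfun : Literature.Analysis.FunctionSpaces.Torus.liftAt (χW s) x = fun _ : V3 => (0 : ℝ) := by
    funext v
    simp [Literature.Analysis.FunctionSpaces.Torus.liftAt, χW]
  rw [hfun, gradient_fun_const]

/-- But the divergence of the witness at `0` is `1` (the partial derivative along `e₀` exists). [folklore] -/
theorem divPsi_witness : divPsi ψW 0 0 = 1 := by
  unfold divPsi Literature.Analysis.FunctionSpaces.Torus.divergence
    Literature.Analysis.FunctionSpaces.Torus.partialDeriv Literature.Analysis.FunctionSpaces.Torus.lineDeriv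
  rw [Fin.sum_univ_three]
  have h0 : deriv (fun t : ℝ => ψW 0 ((0 : T3) +
      Literature.Analysis.FunctionSpaces.Torus.proj (t • (PiLp.single 2 (0 : Fin 3) (1 : ℝ) : V3))) 0) 0 = 1 := by
    have hev : (fun t : ℝ => ψW 0 ((0 : T3) +
        Literature.Analysis.FunctionSpaces.Torus.proj (t • (PiLp.single 2 (0 : Fin 3) (1 : ℝ) : V3))) 0)
        =ᶠ[𝓝 0] fun t => t := by
      have hball : Metric.ball (0 : ℝ) (1 / 2) ∈ 𝓝 (0 : ℝ) := Metric.ball_mem_nhds _ (by norm_num)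
      filter_upwards [hball] with t ht
      rw [Metric.mem_ball, dist_zero_right, Real.norm_eq_abs] at ht
      have hn : ‖t • (PiLp.single 2 (0 : Fin 3) (1 : ℝ) : V3)‖ < 1 / 2 := by
        rw [norm_smul, PiLp.norm_single, norm_one, mul_one, Real.norm_eq_abs]
        exact ht
      simp only [ψW, PiLp.single_apply, if_true]
      rw [hW_chart hn]
      simp
    rw [hev.deriv_eq, deriv_id'']
  have h1 : deriv (fun t : ℝ => ψW 0 ((0 : T3) +
      Literature.Analysis.FunctionSpaces.Torus.proj (t • (PiLp.single 2 (1 : Fin 3) (1 : ℝ) : V3))) 1) 0 = 0 := by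
    simp [ψW]
  have h2 : deriv (fun t : ℝ => ψW 0 ((0 : T3) +
      Literature.Analysis.FunctionSpaces.Torus.proj (t • (PiLp.single 2 (2 : Fin 3) (1 : ℝ) : V3))) 2) 0 = 0 := by
    simp [ψW]
  rw [h0, h1, h2]
  norm_num

/-- The chaos average of the witness vanishes (its sphere-side numerator is identically `0`). [folklore] -/
theorem chaosAvg_witness : chaosAvg ψW χW φW 1 0 wW 0 = 0 := by
  have hsph : ∀ v v' : V3, sphNum ψW χW 0 0 v v' = 0 := by
    intro v v'
    unfold sphNum
    simp
  unfold chaosAvg chaosNum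
  simp [hsph]

/-- Block fields of the witness: `ρ̄ = 1`. [folklore] -/
theorem rhoB_witness : rhoB φW 1 wW 0 = 1 := by
  unfold rhoB φW
  rw [Literature.MathematicalPhysics.KineticTheory.empiricalDensityField_eq_sum]
  simp

/-- Block fields of the witness: `m̄ = e₀/2`. [folklore] -/
theorem mB_witness : mB φW 1 wW 0 = (2 : ℝ)⁻¹ • (PiLp.single 2 (0 : Fin 3) (1 : ℝ) : V3) := by
  unfold mB φW
  rw [Literature.MathematicalPhysics.KineticTheory.empiricalMomentumField_eq_sum]
  simp [wW, Fin.sum_univ_two]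

/-- Block fields of the witness: `Ē = 1/4`. [folklore] -/
theorem EB_witness : EB φW 1 wW 0 = 1 / 4 := by
  unfold EB φW
  rw [Literature.MathematicalPhysics.KineticTheory.empiricalEnergyField_eq_sum]
  simp [wW, Fin.sum_univ_two]
  norm_num

/-- Block fields of the witness: `ρ̄ θ̄ = 1/12 ≠ 0` (the guard of `affW` is inactive). [folklore] -/
theorem pkin_witness : pkin φW 1 wW 0 = 1 / 12 := by
  unfold pkin thetaB
  rw [rhoB_witness, mB_witness, EB_witness, norm_smul, PiLp.norm_single]
  norm_num

/-- The affine weight of the witness is `1/3`. [folklore] -/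
theorem affW_witness : affW ψW χW φW 1 0 wW 0 = 1 / 3 := by
  have hk : kinW ψW χW φW 1 0 wW 0 = 0 := by
    unfold kinW
    simp
  have he : eulerW ψW χW φW 1 0 wW 0 = 1 := by
    unfold eulerW
    simp [divPsi_witness]
  unfold affW
  rw [pkin_witness, he, hk]
  norm_num

/-- **`stub_affineSlaving` is false**: the skeleton's `AffineSlavingIdentity` fails at the witness
(`chaosAvg = 0 ≠ 1/3 = affW`). [folklore] -/
theorem affineSlavingIdentity_false : ¬ AffineSlavingIdentity := by
  intro h
  have h1 := h ψW χW φW 1 0 wW 0 (fun _ => by simp [φW])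
  rw [chaosAvg_witness, affW_witness] at h1
  norm_num at h1

end CollisionalTransferLocalityAffineSlavingFalse

end Summit.AtomisticToContinuum.HydrodynamicLimit.Theorems
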